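import Summits.QuantumFields.BalabanUV.Beta.GAN24.BlockDivergenceFlux
import Summits.QuantumFields.BalabanUV.Beta.GAN24.GaugeReadLayerForm
import Summits.QuantumFields.BalabanUV.Beta.GAN24.LayerLetterUnion

/-!
# `BalabanUV.Beta.GAN24.BlockFluxRegion` — binder row G-an2-4 ∕ (CONV-C), CT-W (route «WC-TL» ∕ (Q-R) «QR-LL», located scalar K-LL-4′): **THE EXACT FLUX RECURSION
# FOR ANY REGION OF COARSE LABELS** — the flux of the S-slot-pushed letter through ANY finite set `T` of coarse labels is the resolvent sandwich of the input letter's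
# flux through the fine refinement of `T`: `Φ_T(e3OfK N K S) = −c_H • mmRead N (K ∘ Φ_{U_N(T)}(S) ∘ K)` — NO table leg, NO layer count IN THE MAP, the region a passive
# label; the COMPLEMENT (regions, general blockings, support ∕ persistence, the kernel-only gain) of the OWNER gan24-p1 g29's BLOCK LAW `GAN24/BoundaryFluxRecursion`
# (`boxSum_divV_e3OfK`: RULING R-gan24p1-g29-1 A1 «`Φ_{B̄}(S_j[s]) = −c_H·mmRead(K_j ∘ Φ_{B̂}(s) ∘ K_j)`, `B̂` the `N²`-block under `B̄`», journal 2026-08-22T15:44Z ∕ INTENT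
# l.44859), around which this file is RE-BASED (my W-1, journal 16:20Z: the block law at blocking `N ↦ N²` is HIS lemma and is not restated here; no import
# dependency either way); G-an2-4 formalisation swarm → CRUX TEAM (2), leaf prover `b2b-balaban-gan24-formalise-leaf-03`, gen 62,
# programme «FLUX-REC» PART 1; module name PROVISIONAL — the row owner gan24-p1 may rename ∕ re-home it)

NOT IN PRINT; OUR BOOKKEEPING.  HONEST FRAMING (cell contract, verbatim): «discharging `BetaPertH` makes Bałaban's UV stability
UNCONDITIONAL — a real constructive-QFT result; it is NOT the continuum limit and NOT the Clay problem.»  HONEST DEPENDENCY (verbatim):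
«continuum YM on T⁴ ⇐ BetaPertH ∧ nine spine estimates (0/9 proved); BetaPertH ⇐ (D1) ∧ (D4) ∧ CAP+tail; G-an2-4 gates asym, D1 and
NE2/3/4.»

WHAT ([folklore] kernel algebra BY NAME over my g58 pair `E3SlotDivergence.divV_e3OfK` (law (L2) of the RULING) + `BlockDivergenceFlux` (`finsetSum_divV_eq_layers`,
`boxSum_divV_eq_faceFlux`), my g58 `Lin4SlotDivergence.sandwich_finset_sum` (the sandwich is additive over finite sums of bounded kernels) ∕ `abs_divV_le` ∕
`abs_finset_sum_le`, leaf-01's `Lin4Additive` (`bdd_comp_decays_bdd ∕ bdd_comp_bdd_decays ∕ bdd_mmRead`), leaf-06 g44's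
`GaugeReadLayerForm.sum_sum_box_eq_sum_biUnion` (a label sum of block sums is one sum over the fine union), my g61 `LayerLetterUnion.biUnion_box_image_eq` (the fine union of a
label box is the dilated block); for ANY decaying packed kernel `K` (rate `δ > 0`), blocking `N ≥ 1`, any BOUNDED first-order family `S`, UNDER the ℋ-column Ward law (hH)
with constant `c_H` — a HYPOTHESIS of §1–§3, DISCHARGED for the comb ∕ wall instance in §4; generic `d`; 0 `def`, 0 cite, 0 `def … : Prop`, 0 sorry).  The FLUX of a
first-order family `S` through a finite set `R` of sites is written out as `Σ_{u ∈ R} divV S u` (= the net flux through `∂R`, `finsetSum_divV_eq_layers`); the fine refinement of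
a finite set `T` of coarse labels is `U_N(T) := T.biUnion (Y ↦ (box (d+1) N).image (v ↦ N•Y + toSite v))` (written out, no `def`).
* §0 `bdd_finsetSum_divV` — the flux of a bounded family through any finite set is a bounded kernel (so the sandwich calculus applies; the block case, stated for
  `Σ_{v ∈ box N}`, is the OWNER's `BoundaryFluxRecursion.bdd_boxSum_divV` — used inline below, not restated).
* §1 **`regionSum_divV_e3OfK`** — FOR EVERY FINITE SET `T` OF COARSE LABELS:
  `Σ_{Y ∈ T} divV (e3OfK N K S) Y = −(c_H • mmRead N (K ∘ (Σ_{u ∈ U_N(T)} divV S u) ∘ K))`;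
  **`boxSum_divV_e3OfK_mul`** — GENERAL BLOCKING: for an `M`-block of labels at `Z`, `Σ_{w ∈ box M} divV (e3OfK N K S) (M•Z + toSite w)
  = −(c_H • mmRead N (K ∘ (Σ_{s ∈ box (N·M)} divV S ((N·M)•Z + toSite s)) ∘ K))` (what the second and later pushes of a block tower need — after one push the input
  region is an `N²`-block; `M = N` is the OWNER's `boxSum_divV_e3OfK`); **`boxSum_divV_e3OfK_mul_faceFlux`** — the same with the fine flux written as the NET FACE FLUX
  through the `2(d+1)` faces of the big block.
* §2 SUPPORT ∕ PERSISTENCE: `finsetSum_divV_eq_layers_inter` (a family vanishing off a finite bond-position set `A` has flux through `R` = its layer sums over `A ∩ ∂R` only),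
  `finsetSum_divV_eq_zero_of_offLayers`, `finsetSum_divV_eq_of_layers_inter_eq` (PERSISTENT faces: equal layer traces on `A` ⇒ equal fluxes — `Φ_{B̂}(S) = Φ_B(S)`), and **`regionSum_divV_e3OfK_eq_zero_of_offLayers`**: a letter whose bonds miss the boundary layers of `U_N(T)` has ZERO coarse
  flux through `T` after the push — EXACTLY (interior letters are invisible to the flux tower; only letters meeting a PERSISTENT face feed it: the OWNER's pre-registered
  G3 prediction ∕ his §READING «non-persistent ⇒ flux-free at the next scale» as an identity).
* §3 THE KERNEL-ONLY GAIN, SUP → SUP: `abs_smul_sandwich_le`, **`abs_regionSum_divV_e3OfK_le`** — if the fine flux through `U_N(T)` has entries `≤ B_Φ` then the coarse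
  flux through `T` has entries `≤ |c_H|·|Fib d|²·(C·Z_δ)²·B_Φ` (`Z_δ = ExpKernelCalculus.Zl (d+1) δ`): an upper bound of the RULING's per-level flux factor
  `ρ_Φ := c_H × (sandwich gain)` in whatever units `K` carries.  LOCATED CAVEAT (leaf-01 g67 R-1, journal l.44982, adopted): this sup → sup form is TRUE AND
  SUPPORT-BLIND — for the END's `K♮ᴱ_j` in `unitS` currency `(C·Z_δ)²·|c_H|` × the step weight `cE·Lc^{2(d+1)} = Lc^{3(d+1)}` is `≍ Lc^{2d}` (the boundary multiplicity
  has moved into `Z_δ²` and into `B_Φ`, the input's flux through the BIGGER region); the support-weighted count (a face weight on `Φ`) displays `Lc^{d−2}` per level — its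
  typed form is leaf-01's complement `GAN24/BoundaryFluxFaceCount` (WANTED, W-2), not this file.
* §4 THE COMB ∕ WALL INSTANCE (`K♮ᴱ_j := unitK (sfStep Lc j) (smStep d Lc j) (coDressKBmAt (toSite r) Lc (KInvStep Lc j))`, `N := Lc`, `c_H = (Lc^{d+1})⁻¹` `j`-free by
  `Lin4SlotDivergence.hH_unitK_comb`): **`regionSum_divV_e3OfK_comb`**, `boxSum_divV_e3OfK_mul_comb`, `regionSum_divV_e3OfK_comb_eq_zero_of_offLayers`.

Asserts NO size of `ρ_Φ` against the END's designed rate (the constants `C, δ` of `K♮ᴱ_j` stay DISPLAYED per level: `decays_coDressKBmAt_KInvStep` is `∃ δ C` per `j`);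
decides nothing about (Q-R) ∕ (DIV) ∕ the (Q-R)^{cc} re-cut; NOT the slot-side charge law (L3) (the OWNER's `TableSlotCoDressCharge`); discharges NOTHING of «T2Shape» ∕
«T2Drift» ∕ (hW, hWall) ∕ (LT) ∕ (LAY) ∕ (S); 0 wall binders; NEVER «G-an2-4 closed» as (CONV-C); NOT D1, NOT `BetaPertH`, NOT continuum, NOT Clay; not in print — our
bookkeeping.  Unit `b2b-balaban-gan24-formalise-leaf-03` (gen 62), 2026-08-22.
-/

noncomputable section

open Finset
open scoped BigOperators
open Literature.MathematicalPhysics.QuantumFieldTheory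
open Literature.MathematicalPhysics.QuantumFieldTheory.Balaban1983to89
open Literature.MathematicalPhysics.QuantumFieldTheory.Balaban1983to89.Beta
open B6BondElimination (unitVec)
open ExpKernelCalculus (MKer Site Decays comp Zl)
open OneStepResolventKernel (Fib)
open OneStepKernelFamily (colH KInvStep)
open BalabanStepJetsSucc (mmRead)
open KernelWard (divV Bdd)
open AffineAveraging (box toSite)
open AxialProjector (toSite_injective)
open Summit.QuantumFields.BalabanUV.Beta.KernelWardRelative (gaugeWt comp_zero_left)
open Literature.MathematicalPhysics.QuantumFieldTheory.Balaban1983to89.Beta.StepDriftWitness (comp_zero_right)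
open Summit.QuantumFields.BalabanUV.Beta.SpineRooted (e3OfK)
open Summit.QuantumFields.BalabanUV.Beta.GAN24.Lin4Additive (bdd_comp_decays_bdd bdd_comp_bdd_decays bdd_mmRead)
open Summit.QuantumFields.BalabanUV.Beta.GAN24.Lin4SlotDivergence (abs_divV_le abs_finset_sum_le sandwich_finset_sum hH_unitK_comb)
open Summit.QuantumFields.BalabanUV.Beta.GAN24.E3SlotDivergence (divV_e3OfK)
open Summit.QuantumFields.BalabanUV.Beta.GAN24.BlockDivergenceFlux (finsetSum_divV_eq_layers boxSum_divV_eq_faceFlux)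
open Summit.QuantumFields.BalabanUV.Beta.GAN24.GaugeReadLayerForm (sum_sum_box_eq_sum_biUnion)
open Summit.QuantumFields.BalabanUV.Beta.GAN24.LayerLetterUnion (biUnion_box_image_eq)
open Summit.QuantumFields.BalabanUV.Beta.HessKerDressedUnits (unitK decays_unitK)
open Summit.QuantumFields.BalabanUV.Beta.GAN24.CombesThomas (sfStep smStep)
open Summit.QuantumFields.BalabanUV.Beta.AxialDressingRooted (coDressKBmAt one_le_of_neZero decays_coDressKBmAt_KInvStep)

namespace Summit.QuantumFields.BalabanUV.Beta.GAN24.BlockFluxRegion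

variable {d N : ℕ}

/-! ## §0 Fluxes of a bounded family through any finite set are bounded kernels -/

/-- [folklore] The flux `Σ_{u ∈ R} divV S u` of a bounded first-order family through any finite set `R` is a bounded kernel (`|R|·(d+1)·2B`). -/
theorem bdd_finsetSum_divV {S : Fin (d + 1) → (Fin (d + 1) → ℤ) → MKer (d + 1) (Fib d)} {B : ℝ} (hS : ∀ κ u x z a b, |S κ u x z a b| ≤ B)
    (R : Finset (Site (d + 1))) :
    Bdd (∑ u ∈ R, divV S u) ((R.card : ℝ) * (((d + 1 : ℕ) : ℝ) * (B + B))) :=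
  fun x z a b => abs_finset_sum_le R (F := fun u => divV S u) (fun u x z a b => abs_divV_le hS u x z a b) x z a b

/-! ## §1 The flux recursion: one push, any region of coarse labels -/

section OneStep

variable {K : MKer (d + 1) (Fib d)} {C δ : ℝ} {S : Fin (d + 1) → (Fin (d + 1) → ℤ) → MKer (d + 1) (Fib d)} {B : ℝ} {cH : ℝ}

/-- [folklore] **THE EXACT FLUX RECURSION** (the OWNER gan24-p1 g29's RULING R-gan24p1-g29-1 A1, for ANY region): for a decaying `K` (rate `δ > 0`), `N ≥ 1`, a bounded
first-order family `S` and (hH) with constant `c_H`, and EVERY finite set `T` of coarse labels,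
`Σ_{Y ∈ T} divV (e3OfK N K S) Y = −(c_H • mmRead N (K ∘ (Σ_{u ∈ ⋃_{Y∈T} (N•Y + box N)} divV S u) ∘ K))` —
the flux of the S-slot-pushed letter through `T` is the RESOLVENT SANDWICH of the input letter's flux through the fine refinement of `T`: NO table leg, NO layer count,
the region is a passive label (law (L2) `divV_e3OfK` label by label, the sandwich's additivity `sandwich_finset_sum`, disjointness of the blocks of distinct labels
`sum_sum_box_eq_sum_biUnion`). -/
theorem regionSum_divV_e3OfK (hK : Decays K C δ) (hδ : 0 < δ) (hN : 1 ≤ N) (hS : ∀ κ u x z a b, |S κ u x z a b| ≤ B)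
    (hH : ∀ (y : Fin (d + 1) → ℤ) (κ' : Fin (d + 1)) (u : Fin (d + 1) → ℤ),
      ∑ μ, (colH K N μ (y - unitVec μ) κ' u - colH K N μ y κ' u) = cH * gaugeWt N y κ' u)
    (T : Finset (Site (d + 1))) :
    ∑ Y ∈ T, divV (e3OfK N K S) Y
      = -(cH • mmRead N (comp (comp K
          (∑ u ∈ T.biUnion (fun Y => (box (d + 1) N).image (fun v => (N : ℤ) • Y + toSite v)), divV S u)) K)) := by
  rw [← sum_sum_box_eq_sum_biUnion T (divV S),
    sandwich_finset_sum T hK hδ N (B := fun _ => ((box (d + 1) N).card : ℝ) * (((d + 1 : ℕ) : ℝ) * (B + B)))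
      (fun Y x z a b => abs_finset_sum_le (box (d + 1) N) (F := fun v => divV S ((N : ℤ) • Y + toSite v))
        (fun _ x z a b => abs_divV_le hS _ x z a b) x z a b), Finset.smul_sum,
    ← Finset.sum_neg_distrib]
  exact Finset.sum_congr rfl fun Y _ => divV_e3OfK hK hδ hN hS hH Y

/-- [folklore] **BLOCKS, GENERAL BLOCKING** (the OWNER's `BoundaryFluxRecursion.boxSum_divV_e3OfK` is `M = N`): for an `M`-block of coarse labels at `Z`,
`Σ_{w ∈ box M} divV (e3OfK N K S) (M•Z + toSite w) = −(c_H • mmRead N (K ∘ (Σ_{s ∈ box (N·M)} divV S ((N·M)•Z + toSite s)) ∘ K))` — the coarse block flux of the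
pushed letter is the kernel sandwich of the input's flux through the BIGGER block under it — the form the second and later pushes of a block tower consume
(`regionSum_divV_e3OfK` at the label block, `biUnion_box_image_eq`). -/
theorem boxSum_divV_e3OfK_mul (hK : Decays K C δ) (hδ : 0 < δ) (hN : 1 ≤ N) (hS : ∀ κ u x z a b, |S κ u x z a b| ≤ B)
    (hH : ∀ (y : Fin (d + 1) → ℤ) (κ' : Fin (d + 1)) (u : Fin (d + 1) → ℤ),
      ∑ μ, (colH K N μ (y - unitVec μ) κ' u - colH K N μ y κ' u) = cH * gaugeWt N y κ' u)
    (M : ℕ) (Z : Site (d + 1)) :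
    ∑ w ∈ box (d + 1) M, divV (e3OfK N K S) ((M : ℤ) • Z + toSite w)
      = -(cH • mmRead N (comp (comp K (∑ s ∈ box (d + 1) (N * M), divV S (((N * M : ℕ) : ℤ) • Z + toSite s))) K)) := by
  classical
  have e1 : ∑ w ∈ box (d + 1) M, divV (e3OfK N K S) ((M : ℤ) • Z + toSite w)
      = ∑ Y ∈ (box (d + 1) M).image (fun w => (M : ℤ) • Z + toSite w), divV (e3OfK N K S) Y :=
    (Finset.sum_image (f := divV (e3OfK N K S)) fun v _ w _ h => toSite_injective (add_left_cancel h)).symm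
  have e2 : ∑ u ∈ (box (d + 1) (N * M)).image (fun s => ((N * M : ℕ) : ℤ) • Z + toSite s), divV S u
      = ∑ s ∈ box (d + 1) (N * M), divV S (((N * M : ℕ) : ℤ) • Z + toSite s) :=
    Finset.sum_image (f := divV S) fun v _ w _ h => toSite_injective (add_left_cancel h)
  rw [e1, regionSum_divV_e3OfK hK hδ hN hS hH, biUnion_box_image_eq hN M Z, e2]

/-- [folklore] **BLOCKS, GENERAL BLOCKING — FACE FORM**: the same with the input's flux through the big block written as its NET FACE FLUX (`boxSum_divV_eq_faceFlux`): the
coarse block flux of the pushed letter reads the input letter ONLY on the `2(d+1)` faces of the `(N·M)`-block — a face of the input's support that is also a face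
of the big block (PERSISTENT) feeds the recursion, nothing else does. -/
theorem boxSum_divV_e3OfK_mul_faceFlux (hK : Decays K C δ) (hδ : 0 < δ) (hN : 1 ≤ N) (hS : ∀ κ u x z a b, |S κ u x z a b| ≤ B)
    (hH : ∀ (y : Fin (d + 1) → ℤ) (κ' : Fin (d + 1)) (u : Fin (d + 1) → ℤ),
      ∑ μ, (colH K N μ (y - unitVec μ) κ' u - colH K N μ y κ' u) = cH * gaugeWt N y κ' u)
    {M : ℕ} (hM : 1 ≤ M) (Z : Site (d + 1)) :
    ∑ w ∈ box (d + 1) M, divV (e3OfK N K S) ((M : ℤ) • Z + toSite w)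
      = -(cH • mmRead N (comp (comp K
          (∑ μ, (∑ s ∈ (box (d + 1) (N * M)).filter (fun s => s μ = 0), S μ (((N * M : ℕ) : ℤ) • Z + toSite s - unitVec μ)
            - ∑ s ∈ (box (d + 1) (N * M)).filter (fun s => s μ = N * M - 1), S μ (((N * M : ℕ) : ℤ) • Z + toSite s)))) K)) := by
  have hNM : 1 ≤ N * M := Nat.one_le_iff_ne_zero.2 (Nat.mul_ne_zero (Nat.one_le_iff_ne_zero.1 hN) (Nat.one_le_iff_ne_zero.1 hM))
  rw [boxSum_divV_e3OfK_mul hK hδ hN hS hH M Z, boxSum_divV_eq_faceFlux hNM S Z]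

end OneStep

/-! ## §2 Support: only the letter's bonds on the boundary layers of the refined region feed the coarse flux -/

/-- [folklore] **A FAMILY VANISHING OFF A FINITE SET `A` OF BOND POSITIONS HAS FLUX THROUGH `R` = ITS LAYER SUMS OVER `A ∩ ∂R` ONLY**:
`Σ_{u ∈ R} divV S u = Σ_μ (Σ_{w ∈ ((R − e_μ) ∖ R) ∩ A} S μ w − Σ_{u ∈ (R ∖ (R − e_μ)) ∩ A} S μ u)` (`finsetSum_divV_eq_layers`, the terms off `A` dropped). -/
theorem finsetSum_divV_eq_layers_inter (R A : Finset (Site (d + 1))) (S : Fin (d + 1) → Site (d + 1) → MKer (d + 1) (Fib d))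
    (hA : ∀ μ u, u ∉ A → S μ u = 0) :
    ∑ u ∈ R, divV S u
      = ∑ μ, (∑ w ∈ (R.image (fun u => u - unitVec μ) \ R) ∩ A, S μ w - ∑ u ∈ (R \ R.image (fun u => u - unitVec μ)) ∩ A, S μ u) := by
  classical
  rw [finsetSum_divV_eq_layers R S]
  refine Finset.sum_congr rfl fun μ _ => ?_
  have h1 : ∀ X : Finset (Site (d + 1)), ∑ w ∈ X, S μ w = ∑ w ∈ X ∩ A, S μ w := by
    intro X
    rw [← Finset.filter_mem_eq_inter, ← Finset.sum_filter_add_sum_filter_not X (fun w => w ∈ A) (fun w => S μ w),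
      Finset.sum_eq_zero (s := X.filter fun w => ¬ w ∈ A) (fun w hw => hA μ w (Finset.mem_filter.1 hw).2), add_zero]
  rw [h1, h1 (R \ R.image (fun u => u - unitVec μ))]

/-- [folklore] **A FAMILY VANISHING ON THE BOUNDARY LAYERS OF `R` HAS ZERO FLUX THROUGH `R`**: if `S μ` vanishes on the entering layer `(R − e_μ) ∖ R` and on the
exiting layer `R ∖ (R − e_μ)` for every `μ`, then `Σ_{u ∈ R} divV S u = 0` (whatever `S` does inside or outside). -/
theorem finsetSum_divV_eq_zero_of_offLayers (R : Finset (Site (d + 1))) (S : Fin (d + 1) → Site (d + 1) → MKer (d + 1) (Fib d))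
    (hin : ∀ μ, ∀ w ∈ R.image (fun u => u - unitVec μ) \ R, S μ w = 0)
    (hout : ∀ μ, ∀ u ∈ R \ R.image (fun u => u - unitVec μ), S μ u = 0) :
    ∑ u ∈ R, divV S u = 0 := by
  rw [finsetSum_divV_eq_layers R S]
  refine Finset.sum_eq_zero fun μ _ => ?_
  rw [Finset.sum_eq_zero (hin μ), Finset.sum_eq_zero (hout μ), sub_zero]

/-- [folklore] **PERSISTENCE: TWO REGIONS WHOSE BOUNDARY LAYERS MEET THE LETTER's BONDS IN THE SAME SETS HAVE THE SAME FLUX**: if `S` vanishes off `A` and, for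
every `μ`, the entering layers of `R₁` and `R₂` agree on `A` and so do the exiting layers, then `Σ_{u ∈ R₁} divV S u = Σ_{u ∈ R₂} divV S u` — e.g. a letter born on a
face of the block `B` that is also a face of the bigger block `B̂ ⊇ B` (a PERSISTENT face) has `Φ_{B̂}(S) = Φ_B(S)` (the OWNER's A1 «for a transported boundary letter
`Φ_{B̂}(s) = Φ_B(s)` iff its face is persistent (else `0`)» — the `else 0` half is `finsetSum_divV_eq_zero_of_offLayers`). -/
theorem finsetSum_divV_eq_of_layers_inter_eq (R₁ R₂ A : Finset (Site (d + 1))) (S : Fin (d + 1) → Site (d + 1) → MKer (d + 1) (Fib d))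
    (hA : ∀ μ u, u ∉ A → S μ u = 0)
    (hin : ∀ μ, (R₁.image (fun u => u - unitVec μ) \ R₁) ∩ A = (R₂.image (fun u => u - unitVec μ) \ R₂) ∩ A)
    (hout : ∀ μ, (R₁ \ R₁.image (fun u => u - unitVec μ)) ∩ A = (R₂ \ R₂.image (fun u => u - unitVec μ)) ∩ A) :
    ∑ u ∈ R₁, divV S u = ∑ u ∈ R₂, divV S u := by
  rw [finsetSum_divV_eq_layers_inter R₁ A S hA, finsetSum_divV_eq_layers_inter R₂ A S hA]
  exact Finset.sum_congr rfl fun μ _ => by rw [hin μ, hout μ]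

section Support

variable {K : MKer (d + 1) (Fib d)} {C δ : ℝ} {S : Fin (d + 1) → (Fin (d + 1) → ℤ) → MKer (d + 1) (Fib d)} {B : ℝ} {cH : ℝ}

/-- [folklore] **INTERIOR LETTERS ARE INVISIBLE TO THE FLUX TOWER — EXACTLY**: if the bounded letter `S` vanishes on the boundary layers of the fine refinement
`U_N(T) = ⋃_{Y∈T} (N•Y + box N)` of a finite set `T` of coarse labels (its bonds do not meet `∂U_N(T)`), then its S-slot-pushed image has ZERO flux through `T`:
`Σ_{Y ∈ T} divV (e3OfK N K S) Y = 0` — only letters meeting a face of the refined region (a PERSISTENT face, for a block tower) feed the recursion (the OWNER's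
pre-registered G3 prediction «`F^{(2)} = 0` at the non-persistent label» as an identity; decaying `K`, (hH)). -/
theorem regionSum_divV_e3OfK_eq_zero_of_offLayers (hK : Decays K C δ) (hδ : 0 < δ) (hN : 1 ≤ N) (hS : ∀ κ u x z a b, |S κ u x z a b| ≤ B)
    (hH : ∀ (y : Fin (d + 1) → ℤ) (κ' : Fin (d + 1)) (u : Fin (d + 1) → ℤ),
      ∑ μ, (colH K N μ (y - unitVec μ) κ' u - colH K N μ y κ' u) = cH * gaugeWt N y κ' u)
    (T : Finset (Site (d + 1)))
    (hin : ∀ μ, ∀ w ∈ (T.biUnion (fun Y => (box (d + 1) N).image (fun v => (N : ℤ) • Y + toSite v))).image (fun u => u - unitVec μ)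
        \ T.biUnion (fun Y => (box (d + 1) N).image (fun v => (N : ℤ) • Y + toSite v)), S μ w = 0)
    (hout : ∀ μ, ∀ u ∈ T.biUnion (fun Y => (box (d + 1) N).image (fun v => (N : ℤ) • Y + toSite v))
        \ (T.biUnion (fun Y => (box (d + 1) N).image (fun v => (N : ℤ) • Y + toSite v))).image (fun u => u - unitVec μ), S μ u = 0) :
    ∑ Y ∈ T, divV (e3OfK N K S) Y = 0 := by
  have h0 : mmRead N (0 : MKer (d + 1) (Fib d)) = 0 := by
    funext x z a b
    cases a <;> cases b <;> simp [mmRead]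
  rw [regionSum_divV_e3OfK hK hδ hN hS hH T, finsetSum_divV_eq_zero_of_offLayers _ S hin hout, comp_zero_right, comp_zero_left, h0, smul_zero,
    neg_zero]

end Support

/-! ## §3 The kernel-only gain of the recursion -/

section Gain

variable {K : MKer (d + 1) (Fib d)} {C δ : ℝ} {S : Fin (d + 1) → (Fin (d + 1) → ℤ) → MKer (d + 1) (Fib d)} {B : ℝ} {cH : ℝ}

/-- [folklore] **THE SCALED SANDWICH OF A BOUNDED KERNEL IS BOUNDED BY A KERNEL-ONLY MULTIPLE OF ITS BOUND**: for a decaying `K` (constants `C, δ`, `δ > 0`) and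
`Bdd V B_V`, `|(c_H • mmRead N (K ∘ V ∘ K)) x z a b| ≤ |c_H|·(|Fib d|·((|Fib d|·(C·Z_δ·B_V))·(C·Z_δ)))` (`bdd_comp_decays_bdd ⨾ bdd_comp_bdd_decays ⨾ bdd_mmRead`). -/
theorem abs_smul_sandwich_le (hK : Decays K C δ) (hδ : 0 < δ) (N : ℕ) (cH : ℝ) {V : MKer (d + 1) (Fib d)} {BV : ℝ} (hV : Bdd V BV)
    (x z : Fin (d + 1) → ℤ) (a b : Fib d) :
    |(cH • mmRead N (comp (comp K V) K)) x z a b|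
      ≤ |cH| * ((Fintype.card (Fib d) : ℝ) * (((Fintype.card (Fib d) : ℝ) * (C * Zl (d + 1) δ * BV)) * (C * Zl (d + 1) δ))) := by
  have h := bdd_mmRead (bdd_comp_bdd_decays (bdd_comp_decays_bdd hK hδ hV) hK hδ) N x z a b
  simp only [Pi.smul_apply, smul_eq_mul, abs_mul]
  exact mul_le_mul_of_nonneg_left h (abs_nonneg _)

/-- [folklore] **THE PER-LEVEL FLUX FACTOR IS KERNEL-ONLY** (the upper bound of the RULING's `ρ_Φ := c_H × (sandwich gain)`): if the input letter's flux through the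
fine refinement `U_N(T)` has entries `≤ B_Φ`, then the pushed letter's flux through `T` has entries
`≤ |c_H|·(|Fib d|·((|Fib d|·(C·Z_δ·B_Φ))·(C·Z_δ)))` — no table constant; the units carried by `K` decide the number.  LOCATED CAVEAT (leaf-01 g67 R-1, adopted):
sup → sup from `Decays` alone is TRUE AND SUPPORT-BLIND — for the END's `K♮ᴱ_j` in `unitS` currency `(C·Z_δ)²·|c_H|` × the step weight `cE·Lc^{2(d+1)} = Lc^{3(d+1)}` is
`≍ Lc^{2d}` (the boundary multiplicity sits in `Z_δ²` and in `B_Φ`, the input's flux through the BIGGER region); the support-weighted count displays `Lc^{d−2}` per level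
(leaf-01's complement `GAN24/BoundaryFluxFaceCount`). -/
theorem abs_regionSum_divV_e3OfK_le (hK : Decays K C δ) (hδ : 0 < δ) (hN : 1 ≤ N) (hS : ∀ κ u x z a b, |S κ u x z a b| ≤ B)
    (hH : ∀ (y : Fin (d + 1) → ℤ) (κ' : Fin (d + 1)) (u : Fin (d + 1) → ℤ),
      ∑ μ, (colH K N μ (y - unitVec μ) κ' u - colH K N μ y κ' u) = cH * gaugeWt N y κ' u)
    (T : Finset (Site (d + 1))) {BΦ : ℝ}
    (hΦ : Bdd (∑ u ∈ T.biUnion (fun Y => (box (d + 1) N).image (fun v => (N : ℤ) • Y + toSite v)), divV S u) BΦ)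
    (x z : Fin (d + 1) → ℤ) (a b : Fib d) :
    |(∑ Y ∈ T, divV (e3OfK N K S) Y) x z a b|
      ≤ |cH| * ((Fintype.card (Fib d) : ℝ) * (((Fintype.card (Fib d) : ℝ) * (C * Zl (d + 1) δ * BΦ)) * (C * Zl (d + 1) δ))) := by
  rw [regionSum_divV_e3OfK hK hδ hN hS hH T, Pi.neg_apply, Pi.neg_apply, Pi.neg_apply, Pi.neg_apply, abs_neg]
  exact abs_smul_sandwich_le hK hδ N cH hΦ x z a b

/-- [folklore] The same with the a-priori bound of §0 for the fine flux (`B_Φ := |U_N(T)|·(d+1)·2B`): the recursion never loses boundedness. -/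
theorem abs_regionSum_divV_e3OfK_le' (hK : Decays K C δ) (hδ : 0 < δ) (hN : 1 ≤ N) (hS : ∀ κ u x z a b, |S κ u x z a b| ≤ B)
    (hH : ∀ (y : Fin (d + 1) → ℤ) (κ' : Fin (d + 1)) (u : Fin (d + 1) → ℤ),
      ∑ μ, (colH K N μ (y - unitVec μ) κ' u - colH K N μ y κ' u) = cH * gaugeWt N y κ' u)
    (T : Finset (Site (d + 1))) (x z : Fin (d + 1) → ℤ) (a b : Fib d) :
    |(∑ Y ∈ T, divV (e3OfK N K S) Y) x z a b|
      ≤ |cH| * ((Fintype.card (Fib d) : ℝ) * (((Fintype.card (Fib d) : ℝ) * (C * Zl (d + 1) δ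
          * (((T.biUnion (fun Y => (box (d + 1) N).image (fun v => (N : ℤ) • Y + toSite v))).card : ℝ) * (((d + 1 : ℕ) : ℝ) * (B + B)))))
          * (C * Zl (d + 1) δ))) :=
  abs_regionSum_divV_e3OfK_le hK hδ hN hS hH T (bdd_finsetSum_divV hS _) x z a b

end Gain

/-! ## §4 The comb ∕ wall instance -/

section Comb

variable {Lc : ℕ} [NeZero Lc] {r : Fin (d + 1) → ℕ} {S : Fin (d + 1) → (Fin (d + 1) → ℤ) → MKer (d + 1) (Fib d)} {B : ℝ}

/-- [folklore] **THE FLUX RECURSION FOR THE NORMALISED CO-DRESSED STEP RESOLVENT** (every `j`, every in-block root `r`, every bounded `S`, every finite `T`):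
`Σ_{Y ∈ T} divV (e3OfK Lc K♮ᴱ_j S) Y = −((Lc^{d+1})⁻¹ • mmRead Lc (K♮ᴱ_j ∘ (Σ_{u ∈ U_{Lc}(T)} divV S u) ∘ K♮ᴱ_j))`, `K♮ᴱ_j = unitK (sfStep Lc j) (smStep d Lc j)
(coDressKBmAt (toSite r) Lc (KInvStep Lc j))` — the `j`-FREE scalar `(Lc^{d+1})⁻¹` of `hH_unitK_comb`; the kernel's decay constants are those of
`decays_coDressKBmAt_KInvStep` at level `j` (displayed there, per level). -/
theorem regionSum_divV_e3OfK_comb (hr : r ∈ box (d + 1) Lc) (j : ℕ) (hS : ∀ κ u x z a b, |S κ u x z a b| ≤ B) (T : Finset (Site (d + 1))) :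
    ∑ Y ∈ T, divV (e3OfK Lc (unitK (sfStep Lc j) (smStep d Lc j) (coDressKBmAt (toSite r) Lc (KInvStep (d := d) Lc j))) S) Y
      = -(((Lc : ℝ) ^ (d + 1))⁻¹ • mmRead Lc
          (comp (comp (unitK (sfStep Lc j) (smStep d Lc j) (coDressKBmAt (toSite r) Lc (KInvStep (d := d) Lc j)))
            (∑ u ∈ T.biUnion (fun Y => (box (d + 1) Lc).image (fun v => (Lc : ℤ) • Y + toSite v)), divV S u))
            (unitK (sfStep Lc j) (smStep d Lc j) (coDressKBmAt (toSite r) Lc (KInvStep (d := d) Lc j))))) := by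
  obtain ⟨δK, CK, hδK, -, hG⟩ := decays_coDressKBmAt_KInvStep (d := d) hr j
  exact regionSum_divV_e3OfK (decays_unitK hG) hδK (one_le_of_neZero Lc) hS (hH_unitK_comb hr j) T

/-- [folklore] **THE COMB STEP — BLOCKS, GENERAL BLOCKING** (every `j`, in-block root, bounded `S`, any `M`, any coarse label `Z`; `M = Lc` is the OWNER's
`BoundaryFluxRecursion.boxSum_divV_e3OfK_comb`):
`Σ_{w ∈ box M} divV (e3OfK Lc K♮ᴱ_j S) (M•Z + toSite w) = −((Lc^{d+1})⁻¹ • mmRead Lc (K♮ᴱ_j ∘ (Σ_{s ∈ box (Lc·M)} divV S ((Lc·M)•Z + toSite s)) ∘ K♮ᴱ_j))`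
. -/
theorem boxSum_divV_e3OfK_mul_comb (hr : r ∈ box (d + 1) Lc) (j : ℕ) (hS : ∀ κ u x z a b, |S κ u x z a b| ≤ B) (M : ℕ) (Z : Site (d + 1)) :
    ∑ w ∈ box (d + 1) M, divV (e3OfK Lc (unitK (sfStep Lc j) (smStep d Lc j) (coDressKBmAt (toSite r) Lc (KInvStep (d := d) Lc j))) S)
        ((M : ℤ) • Z + toSite w)
      = -(((Lc : ℝ) ^ (d + 1))⁻¹ • mmRead Lc
          (comp (comp (unitK (sfStep Lc j) (smStep d Lc j) (coDressKBmAt (toSite r) Lc (KInvStep (d := d) Lc j)))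
            (∑ s ∈ box (d + 1) (Lc * M), divV S (((Lc * M : ℕ) : ℤ) • Z + toSite s)))
            (unitK (sfStep Lc j) (smStep d Lc j) (coDressKBmAt (toSite r) Lc (KInvStep (d := d) Lc j))))) := by
  obtain ⟨δK, CK, hδK, -, hG⟩ := decays_coDressKBmAt_KInvStep (d := d) hr j
  exact boxSum_divV_e3OfK_mul (decays_unitK hG) hδK (one_le_of_neZero Lc) hS (hH_unitK_comb hr j) M Z

/-- [folklore] **INTERIOR LETTERS ARE INVISIBLE TO THE COMB's FLUX TOWER** (every `j`, in-block root): a bounded letter vanishing on the boundary layers of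
`U_{Lc}(T)` has `Σ_{Y ∈ T} divV (e3OfK Lc K♮ᴱ_j S) Y = 0`. -/
theorem regionSum_divV_e3OfK_comb_eq_zero_of_offLayers (hr : r ∈ box (d + 1) Lc) (j : ℕ) (hS : ∀ κ u x z a b, |S κ u x z a b| ≤ B)
    (T : Finset (Site (d + 1)))
    (hin : ∀ μ, ∀ w ∈ (T.biUnion (fun Y => (box (d + 1) Lc).image (fun v => (Lc : ℤ) • Y + toSite v))).image (fun u => u - unitVec μ)
        \ T.biUnion (fun Y => (box (d + 1) Lc).image (fun v => (Lc : ℤ) • Y + toSite v)), S μ w = 0)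
    (hout : ∀ μ, ∀ u ∈ T.biUnion (fun Y => (box (d + 1) Lc).image (fun v => (Lc : ℤ) • Y + toSite v))
        \ (T.biUnion (fun Y => (box (d + 1) Lc).image (fun v => (Lc : ℤ) • Y + toSite v))).image (fun u => u - unitVec μ), S μ u = 0) :
    ∑ Y ∈ T, divV (e3OfK Lc (unitK (sfStep Lc j) (smStep d Lc j) (coDressKBmAt (toSite r) Lc (KInvStep (d := d) Lc j))) S) Y = 0 := by
  obtain ⟨δK, CK, hδK, -, hG⟩ := decays_coDressKBmAt_KInvStep (d := d) hr j
  exact regionSum_divV_e3OfK_eq_zero_of_offLayers (decays_unitK hG) hδK (one_le_of_neZero Lc) hS (hH_unitK_comb hr j) T hin hout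

end Comb

end Summit.QuantumFields.BalabanUV.Beta.GAN24.BlockFluxRegion

end
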